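import Summits.CriticalPhenomena.PercolationContinuityZ3.Theorems.PercNearOneGluingNoHeavyPcintNawGrowth
import Literature.Probability.RandomPlanarGeometry.SAWDimensionGap
import HarnessLib

/-!
# CriticalPhenomena/PercolationContinuityZ3 — Theorems/PercNearOneGluingNoHeavyPcintNawDimensionGap.lean:
# the UNIT GAP `μ_NAW(ℤ^d) + 1 ≤ μ_NAW(ℤ^{d+1})` for neighbour-avoiding walks (interleaving)

Lane prim-pcint (PAPER-2 track (iii)), seat prim-pcint-2, STRUCTURE rule (the `τ = ∞` endpoint `1/μ_NAW(ℤ^d)` of the site counting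
column B2, …PcintNawGrowth; the lane's numbers `μ_NAW(ℤ³) ≈ 4.046`, `μ_NAW(ℤ⁴) ≈ 5.99`, `μ_NAW(ℤ⁵) ≈ 7.97` decrease the endpoint with `d`).
The tree has the SAW unit gap `μ(ℤ^d) + 1 ≤ μ(ℤ^{d+1})` (`SAW.Zd.connectiveConstant_add_one_le`, …SAWDimensionGap: an `(n−k)`-step SAW of
`ℤ^d` INTERLEAVED with `k` unit steps in the new coordinate direction at chosen times is an `n`-step SAW of `ℤ^{d+1}`, and the pair can be
read off; `Σ_k C(n,k) c_{n−k}(ℤ^d) ≤ c_n(ℤ^{d+1})`).  OBSERVATION: the interleaving of a NEIGHBOUR-AVOIDING walk is neighbour-avoiding —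
all inserted steps point UP, so two sites of the interleaved walk are lattice neighbours only if they have the same height and adjacent base
points (consecutive base times with no lift in between, i.e. consecutive) or the same base point and heights differing by one (one lift in
between, i.e. consecutive) (`interleave_mem_nawFuns`).  Hence

* `sum_choose_mul_nawCount_le` — `Σ_{k ≤ n} C(n,k) N_{n−k}(ℤ^d) ≤ N_n(ℤ^{d+1})`;
* `add_one_pow_le_nawCount_succ` — `(μ_NAW(ℤ^d) + 1)^n ≤ N_n(ℤ^{d+1})`;
* **`nawConst_add_one_le`** — `μ_NAW(ℤ^d) + 1 ≤ μ_NAW(ℤ^{d+1})`, `nawConst_lt_succ`, `strictMono_nawConst`;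
* `inv_nawConst_succ_lt` — the site endpoints `1/μ_NAW(ℤ^d)` are STRICTLY DECREASING in `d`.

Vocabulary bridge: `nawFuns d n` = the `n`-step NAWs in the vertex-function model `SAW.Zd.saws` (`card_nawFuns_eq : #nawFuns d n = nawCount d n`,
via the tree's word ↦ path injection `MemoryTail.wordPath_mem_saws` / `wordPath_injective` and the count equality `card_sawWords_eq_count`).
HONEST FRAMING: a structural fact (no certified cell moves).  Everything PROVED; written by prim-pcint-2 gen 16 (prover-prim-pcint-2-g16-0), 2026-08-24.
-/

noncomputable section

open Filter Topology
open Literature.Probability.LatticeModels Literature.Probability.Percolation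
open Literature.Probability.RandomPlanarGeometry.SAW.Zd

namespace Summit.CriticalPhenomena.PercolationContinuityZ3.Theorems.Pcint.NawTail

variable {d : ℕ}

/-! ### NAWs in the vertex-function model -/

open Classical in
/-- The `n`-step neighbour-avoiding walks of `ℤ^d` as vertex functions (the format of `SAW.Zd.saws`): self-avoiding, and no two sites two
or more steps apart are lattice neighbours. [folklore] -/
def nawFuns (d n : ℕ) : Finset (ℕ → Site d) :=
  (saws d n).filter fun ω => ∀ i j : ℕ, i + 2 ≤ j → j ≤ n → ¬ (zdGraph d).Adj (ω i) (ω j)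

open Classical in
/-- Membership in `nawFuns`. [folklore] -/
theorem mem_nawFuns {n : ℕ} {ω : ℕ → Site d} :
    ω ∈ nawFuns d n ↔ ω ∈ saws d n ∧ ∀ i j : ℕ, i + 2 ≤ j → j ≤ n → ¬ (zdGraph d).Adj (ω i) (ω j) := by
  rw [nawFuns, Finset.mem_filter]

/-- `nawFuns ⊆ saws`. [folklore] -/
theorem nawFuns_subset_saws (d n : ℕ) : nawFuns d n ⊆ saws d n := fun _ h => (mem_nawFuns.1 h).1

/-- The lattice path of a neighbour-avoiding WORD is a neighbour-avoiding vertex function. [folklore] -/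
theorem wordPath_mem_nawFuns {n : ℕ} {w : Fin n → Fin d × Bool} (hw : IsNAW w) :
    (fun i : ℕ => wordPos w (min i n)) ∈ nawFuns d n := by
  refine mem_nawFuns.2 ⟨MemoryTail.wordPath_mem_saws hw.1, fun i j hij hj => ?_⟩
  simp only [min_eq_left (by omega : i ≤ n), min_eq_left hj]
  exact hw.2 i j hij hj

/-- `N_n(ℤ^d) ≤ #nawFuns d n` (the word ↦ path injection). [folklore] -/
theorem nawCount_le_card_nawFuns (d n : ℕ) : nawCount d n ≤ (nawFuns d n).card := by
  classical
  unfold nawCount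
  refine Finset.card_le_card_of_injOn (fun (w : Fin n → Fin d × Bool) (i : ℕ) => wordPos w (min i n))
    (fun w hw => ?_) (MemoryTail.wordPath_injective n).injOn
  rw [Finset.mem_coe, mem_nawWords] at hw
  exact Finset.mem_coe.2 (wordPath_mem_nawFuns hw)

/-- Every `n`-step SAW in the vertex-function model is the path of a self-avoiding word (the injection `sawWords → saws` is onto, by the count
equality `card_sawWords_eq_count`). [cite: MadrasSlade1993, §1.1] -/
theorem exists_word_of_mem_saws [NeZero d] {n : ℕ} {ω : ℕ → Site d} (hω : ω ∈ saws d n) :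
    ∃ w : Fin n → Fin d × Bool, IsSAW w ∧ (fun i : ℕ => wordPos w (min i n)) = ω := by
  classical
  set img := (sawWords d n).image (fun (w : Fin n → Fin d × Bool) (i : ℕ) => wordPos w (min i n)) with himg
  have hsub : img ⊆ saws d n := by
    intro ω' hω'
    obtain ⟨w, hw, rfl⟩ := Finset.mem_image.1 hω'
    exact MemoryTail.wordPath_mem_saws (mem_sawWords.1 hw)
  have hcard : (saws d n).card ≤ img.card := by
    rw [himg, Finset.card_image_of_injective _ (MemoryTail.wordPath_injective n), card_saws,
      ← MemoryTail.card_sawWords_eq_count]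
  have heq : img = saws d n := Finset.eq_of_subset_of_card_le hsub hcard
  rw [← heq] at hω
  obtain ⟨w, hw, hwω⟩ := Finset.mem_image.1 hω
  exact ⟨w, mem_sawWords.1 hw, hwω⟩

/-- `#nawFuns d n ≤ N_n(ℤ^d)`: a neighbour-avoiding vertex function is the path of a neighbour-avoiding word. [folklore] -/
theorem card_nawFuns_le_nawCount [NeZero d] (n : ℕ) : (nawFuns d n).card ≤ nawCount d n := by
  classical
  have hsub : nawFuns d n ⊆ (nawWords d n).image (fun (w : Fin n → Fin d × Bool) (i : ℕ) => wordPos w (min i n)) := by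
    intro ω hω
    obtain ⟨hωs, hωn⟩ := mem_nawFuns.1 hω
    obtain ⟨w, hw, rfl⟩ := exists_word_of_mem_saws hωs
    refine Finset.mem_image.2 ⟨w, mem_nawWords.2 ⟨hw, fun i j hij hj hadj => hωn i j hij hj ?_⟩, rfl⟩
    simp only [min_eq_left (by omega : i ≤ n), min_eq_left hj]
    exact hadj
  exact (Finset.card_le_card hsub).trans Finset.card_image_le

/-- **`#nawFuns d n = N_n(ℤ^d)`** (`d ≥ 1`): the two NAW counts of the tree agree. [folklore] -/
theorem card_nawFuns_eq [NeZero d] (n : ℕ) : (nawFuns d n).card = nawCount d n :=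
  le_antisymm (card_nawFuns_le_nawCount n) (nawCount_le_card_nawFuns d n)

/-! ### Lifted sites and their adjacencies -/

/-- Coordinates of a lifted site: the new (zeroth) coordinate. [folklore] -/
theorem liftSite_apply_zero (h : ℤ) (x : Site d) : liftSite h x 0 = h := rfl

/-- Coordinates of a lifted site: the old coordinates. [folklore] -/
theorem liftSite_apply_succ (h : ℤ) (x : Site d) (j : Fin d) : liftSite h x j.succ = x j := by
  simp [liftSite]

/-- **Neighbours among lifted sites**: `liftSite h x ∼ liftSite h' x'` only if the heights agree and the base points are neighbours, or the
base points agree and the heights differ by one. [cite: MadrasSlade1993, §1.1] -/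
theorem liftSite_adj_cases {h h' : ℤ} {x x' : Site d} (H : (zdGraph (d + 1)).Adj (liftSite h x) (liftSite h' x')) :
    (h = h' ∧ (zdGraph d).Adj x x') ∨ (x = x' ∧ (h' = h + 1 ∨ h = h' + 1)) := by
  rw [zdGraph_adj_iff] at H
  obtain ⟨i, hi⟩ := H
  -- evaluate a vector identity `a = b + e_i` at a coordinate
  have ev : ∀ {a b : Site (d + 1)}, a = b + Pi.single i 1 → ∀ j : Fin (d + 1),
      a j = b j + (Pi.single i (1 : ℤ) : Site (d + 1)) j := fun e j => by rw [e]; rfl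
  rcases Fin.eq_zero_or_eq_succ i with rfl | ⟨i', rfl⟩
  · -- a step in the new direction: base points agree, heights differ by one
    right
    rcases hi with e | e
    · have e0 := ev e 0
      simp only [liftSite_apply_zero, Pi.single_eq_same] at e0
      have es : x' = x := funext fun j => by
        have := ev e j.succ
        simpa [liftSite_apply_succ, Pi.single_apply, Fin.succ_ne_zero] using this
      exact ⟨es.symm, Or.inl e0⟩
    · have e0 := ev e 0
      simp only [liftSite_apply_zero, Pi.single_eq_same] at e0
      have es : x = x' := funext fun j => by
        have := ev e j.succ
        simpa [liftSite_apply_succ, Pi.single_apply, Fin.succ_ne_zero] using this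
      exact ⟨es, Or.inr e0⟩
  · -- a step in an old direction: heights agree, base points are neighbours
    left
    have key : ∀ {a b : Site d} {ha hb : ℤ}, liftSite hb b = liftSite ha a + Pi.single i'.succ 1 →
        hb = ha ∧ b = a + Pi.single i' 1 := by
      intro a b ha hb e
      refine ⟨?_, funext fun j => ?_⟩
      · have e0 := ev e 0
        simpa [liftSite_apply_zero, Pi.single_apply, (Fin.succ_ne_zero i').symm] using e0
      · have := ev e j.succ
        simp only [liftSite_apply_succ, Pi.single_apply, Fin.succ_inj] at this
        rw [this]
        simp [Pi.single_apply]
    rcases hi with e | e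
    · obtain ⟨hh, hb⟩ := key e
      exact ⟨hh.symm, (zdGraph_adj_iff x x').2 ⟨i', Or.inl hb⟩⟩
    · obtain ⟨hh, hb⟩ := key e
      exact ⟨hh, (zdGraph_adj_iff x x').2 ⟨i', Or.inr hb⟩⟩

/-! ### The number of lifts before a time -/

/-- `liftsBefore` is monotone in time. [folklore] -/
theorem liftsBefore_mono' (S : Finset ℕ) {i j : ℕ} (h : i ≤ j) : liftsBefore S i ≤ liftsBefore S j := by
  unfold liftsBefore
  refine Finset.card_le_card fun t ht => ?_
  simp only [Finset.mem_filter] at ht ⊢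
  exact ⟨ht.1, lt_of_lt_of_le ht.2 h⟩

/-- Between times `i` and `j` there are at most `j − i` lifts (truncated subtraction). [folklore] -/
theorem liftsBefore_sub_le (S : Finset ℕ) (i j : ℕ) : liftsBefore S j ≤ liftsBefore S i + (j - i) := by
  classical
  unfold liftsBefore
  have hsplit : S.filter (· < j) ⊆ S.filter (· < i) ∪ (Finset.Ico i j) := by
    intro t ht
    simp only [Finset.mem_filter] at ht
    simp only [Finset.mem_union, Finset.mem_filter, Finset.mem_Ico]
    by_cases hti : t < i
    · exact Or.inl ⟨ht.1, hti⟩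
    · exact Or.inr ⟨by omega, ht.2⟩
  calc (S.filter (· < j)).card ≤ (S.filter (· < i) ∪ Finset.Ico i j).card := Finset.card_le_card hsplit
    _ ≤ (S.filter (· < i)).card + (Finset.Ico i j).card := Finset.card_union_le _ _
    _ = (S.filter (· < i)).card + (j - i) := by rw [Nat.card_Ico]

/-- At most `i` lifts before time `i`. [folklore] -/
theorem liftsBefore_le' (S : Finset ℕ) (i : ℕ) : liftsBefore S i ≤ i := by
  have := liftsBefore_sub_le S 0 i
  have h0 : liftsBefore S 0 = 0 := by simp [liftsBefore]
  rw [h0] at this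
  omega

/-- If all lift times are `< n`, then from time `n` on all `#S` lifts have happened. [folklore] -/
theorem liftsBefore_eq_card {S : Finset ℕ} {n : ℕ} (hS : S ⊆ Finset.range n) {i : ℕ} (hi : n ≤ i) :
    liftsBefore S i = S.card := by
  unfold liftsBefore
  congr 1
  exact Finset.filter_true_of_mem fun t ht => lt_of_lt_of_le (Finset.mem_range.1 (hS ht)) hi

/-! ### Interleaving a neighbour-avoiding walk gives a neighbour-avoiding walk -/

/-- **The interleaving of a NAW is a NAW.** For lift times `S ⊆ {0,…,n−1}` and `ω ∈ nawFuns d (n − #S)`,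
`interleave S ω ∈ nawFuns (d+1) n`: all inserted steps point up, so two lattice-neighbouring sites of the interleaved walk have either the
same height and adjacent base points — then no lift lies between them and their base times differ by their time difference, which the base
NAW forbids unless it is `1` — or the same base point and heights one apart — exactly one lift and no base step between them, so they are
consecutive. [folklore] -/
theorem interleave_mem_nawFuns {n : ℕ} {S : Finset ℕ} (hS : S ⊆ Finset.range n) (hSn : S.card ≤ n)
    {ω : ℕ → Site d} (hω : ω ∈ nawFuns d (n - S.card)) : interleave S ω ∈ nawFuns (d + 1) n := by
  obtain ⟨hωs, hωn⟩ := mem_nawFuns.1 hω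
  refine mem_nawFuns.2 ⟨interleave_mem_saws hS hSn hωs, fun i j hij hj hadj => ?_⟩
  set k := S.card with hk
  -- horizontal indices stay `≤ n - k` up to time `n`
  have hidx : ∀ t, t ≤ n → t - liftsBefore S t ≤ n - k := fun t ht => by
    have h1 := liftsBefore_sub_le S t n
    rw [liftsBefore_eq_card hS le_rfl] at h1
    have h2 := liftsBefore_le' S t
    omega
  have hℓi := liftsBefore_le' S i
  have hℓj := liftsBefore_le' S j
  have hmono := liftsBefore_mono' S (show i ≤ j by omega)
  unfold interleave at hadj
  rcases liftSite_adj_cases hadj with ⟨hh, hbase⟩ | ⟨hbase, hh⟩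
  · -- same height: the base points are `j - i ≥ 2` base steps apart
    have hh' : liftsBefore S i = liftsBefore S j := by exact_mod_cast hh
    exact hωn (i - liftsBefore S i) (j - liftsBefore S j) (by omega) (hidx j hj) hbase
  · -- same base point: the base times agree, so exactly one lift separates `i` and `j`, i.e. `j = i + 1`
    have hinj := (mem_saws.1 hωs).2.2.2
    have hab : i - liftsBefore S i = j - liftsBefore S j :=
      hinj (show i - liftsBefore S i ∈ {t | t ≤ n - k} from hidx i (by omega))
        (show j - liftsBefore S j ∈ {t | t ≤ n - k} from hidx j hj) hbase
    rcases hh with hh | hh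
    · have : (liftsBefore S j : ℤ) = liftsBefore S i + 1 := hh
      have hh' : liftsBefore S j = liftsBefore S i + 1 := by exact_mod_cast this
      omega
    · have : (liftsBefore S i : ℤ) = liftsBefore S j + 1 := hh
      have hh' : liftsBefore S i = liftsBefore S j + 1 := by exact_mod_cast this
      omega

/-- The interleaved walk has final height `#S` (so walks with different numbers of lifts differ). [folklore] -/
theorem interleave_apply_zero_eq_card {n : ℕ} {S : Finset ℕ} (hS : S ⊆ Finset.range n) (ω : ℕ → Site d) :
    interleave S ω n 0 = S.card := by
  simp [interleave, liftsBefore_eq_card hS le_rfl]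

/-! ### Counting: `Σ_k C(n,k) N_{n−k}(ℤ^d) ≤ N_n(ℤ^{d+1})` -/

/-- **The interleaving bound for NAWs**: `Σ_{k ≤ n} C(n,k) · #nawFuns d (n−k) ≤ #nawFuns (d+1) n` (choose the `k` lift times and an
`(n−k)`-step NAW of `ℤ^d`; the interleavings are distinct NAWs of `ℤ^{d+1}`, `interleave_injOn`). [folklore] -/
theorem sum_choose_mul_card_nawFuns_le (d n : ℕ) :
    ∑ k ∈ Finset.range (n + 1), n.choose k * (nawFuns d (n - k)).card ≤ (nawFuns (d + 1) n).card := by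
  classical
  let F : ℕ → Finset (ℕ → Site (d + 1)) := fun j =>
    (((Finset.range n).powersetCard j) ×ˢ nawFuns d (n - j)).image fun p => interleave p.1 p.2
  have hFsub : ∀ j, j ≤ n → F j ⊆ nawFuns (d + 1) n := by
    intro j hj x hx
    obtain ⟨⟨S, ω⟩, hp, rfl⟩ := Finset.mem_image.1 hx
    obtain ⟨hS, hω⟩ := Finset.mem_product.1 hp
    obtain ⟨hSr, hSc⟩ := Finset.mem_powersetCard.1 hS
    exact interleave_mem_nawFuns hSr (by omega) (by rw [hSc]; exact hω)
  have hFcard : ∀ j, j ≤ n → (F j).card = n.choose j * (nawFuns d (n - j)).card := by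
    intro j hj
    rw [Finset.card_image_of_injOn, Finset.card_product, Finset.card_powersetCard, Finset.card_range]
    rintro ⟨S, ω⟩ hp ⟨S', ω'⟩ hp' hEq
    obtain ⟨hS, hω⟩ := Finset.mem_product.1 (Finset.mem_coe.1 hp)
    obtain ⟨hS', hω'⟩ := Finset.mem_product.1 (Finset.mem_coe.1 hp')
    obtain ⟨hSr, hSc⟩ := Finset.mem_powersetCard.1 hS
    obtain ⟨hSr', hSc'⟩ := Finset.mem_powersetCard.1 hS'
    obtain ⟨h1, h2⟩ := interleave_injOn hSr hSr' hSc hSc' (nawFuns_subset_saws _ _ hω) (nawFuns_subset_saws _ _ hω') hEq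
    exact Prod.ext h1 h2
  have hFdisj : ∀ j, j ≤ n → ∀ j', j' ≤ n → j ≠ j' → Disjoint (F j) (F j') := by
    intro j hj j' hj' hne
    rw [Finset.disjoint_left]
    intro x hx hx'
    obtain ⟨⟨S, ω⟩, hp, rfl⟩ := Finset.mem_image.1 hx
    obtain ⟨⟨S', ω'⟩, hp', hEq⟩ := Finset.mem_image.1 hx'
    obtain ⟨hS, -⟩ := Finset.mem_product.1 hp
    obtain ⟨hS', -⟩ := Finset.mem_product.1 hp'
    obtain ⟨hSr, hSc⟩ := Finset.mem_powersetCard.1 hS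
    obtain ⟨hSr', hSc'⟩ := Finset.mem_powersetCard.1 hS'
    have h1 := interleave_apply_zero_eq_card hSr ω
    have h2 := interleave_apply_zero_eq_card hSr' ω'
    simp only at hEq
    rw [hEq, h1, hSc, hSc'] at h2
    exact hne (by exact_mod_cast h2)
  calc ∑ j ∈ Finset.range (n + 1), n.choose j * (nawFuns d (n - j)).card
      = ∑ j ∈ Finset.range (n + 1), (F j).card :=
        Finset.sum_congr rfl fun j hj => (hFcard j (by simpa [Nat.lt_succ_iff] using hj)).symm
    _ = ((Finset.range (n + 1)).biUnion F).card := by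
        rw [Finset.card_biUnion]
        intro j hj j' hj' hne
        exact hFdisj j (by simpa [Nat.lt_succ_iff] using hj) j' (by simpa [Nat.lt_succ_iff] using hj') hne
    _ ≤ (nawFuns (d + 1) n).card := by
        refine Finset.card_le_card (Finset.biUnion_subset.2 fun j hj => hFsub j ?_)
        simpa [Nat.lt_succ_iff] using hj

/-- **`Σ_{k ≤ n} C(n,k) N_{n−k}(ℤ^d) ≤ N_n(ℤ^{d+1})`** (`d ≥ 1`), in the lane's word counts `nawCount`. [folklore] -/
theorem sum_choose_mul_nawCount_le [NeZero d] (n : ℕ) :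
    ∑ k ∈ Finset.range (n + 1), n.choose k * nawCount d (n - k) ≤ nawCount (d + 1) n := by
  calc ∑ k ∈ Finset.range (n + 1), n.choose k * nawCount d (n - k)
      ≤ ∑ k ∈ Finset.range (n + 1), n.choose k * (nawFuns d (n - k)).card :=
        Finset.sum_le_sum fun k _ => Nat.mul_le_mul_left _ (nawCount_le_card_nawFuns d (n - k))
    _ ≤ (nawFuns (d + 1) n).card := sum_choose_mul_card_nawFuns_le d n
    _ ≤ nawCount (d + 1) n := card_nawFuns_le_nawCount (d := d + 1) n

/-- The same indexed by the number `m` of `ℤ^d`-steps: `Σ_{m ≤ n} C(n,m) N_m(ℤ^d) ≤ N_n(ℤ^{d+1})`. [folklore] -/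
theorem sum_choose_mul_nawCount_le' [NeZero d] (n : ℕ) :
    ∑ m ∈ Finset.range (n + 1), n.choose m * nawCount d m ≤ nawCount (d + 1) n := by
  calc ∑ m ∈ Finset.range (n + 1), n.choose m * nawCount d m
      = ∑ j ∈ Finset.range (n + 1), n.choose (n - j) * nawCount d (n - j) := by
        rw [← Finset.sum_range_reflect]
        simp only [Nat.add_sub_cancel]
    _ = ∑ j ∈ Finset.range (n + 1), n.choose j * nawCount d (n - j) := by
        refine Finset.sum_congr rfl fun j hj => ?_
        rw [Nat.choose_symm (by simpa [Nat.lt_succ_iff] using hj)]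
    _ ≤ nawCount (d + 1) n := sum_choose_mul_nawCount_le n

/-! ### `μ_NAW(ℤ^{d+1}) ≥ μ_NAW(ℤ^d) + 1` -/

/-- `μ_NAW(ℤ^d)^m ≤ N_m(ℤ^d)` for every `m` (`μ_NAW` is the infimum of `N_m^{1/m}`). [folklore] -/
theorem pow_nawConst_le_nawCount [NeZero d] (m : ℕ) : nawConst d ^ m ≤ (nawCount d m : ℝ) := by
  rcases Nat.eq_zero_or_pos m with rfl | hm
  · simp only [pow_zero]
    exact_mod_cast one_le_nawCount (d := d) 0
  · have h := nawConst_le_rpow d (n := m) (by omega)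
    have hμ : 0 ≤ nawConst d := (nawConst_pos (d := d)).le
    have hm' : (0 : ℝ) < m := by exact_mod_cast hm
    calc nawConst d ^ m ≤ ((nawCount d m : ℝ) ^ (1 / (m : ℝ))) ^ m := pow_le_pow_left₀ hμ h m
      _ = nawCount d m := by
          rw [← Real.rpow_natCast, ← Real.rpow_mul (Nat.cast_nonneg _), one_div_mul_cancel hm'.ne', Real.rpow_one]

/-- `(μ_NAW(ℤ^d) + 1)ⁿ ≤ N_n(ℤ^{d+1})` for every `n` (binomial theorem, `μ_NAW^m ≤ N_m` and the interleaving bound). [folklore] -/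
theorem add_one_pow_le_nawCount_succ [NeZero d] (n : ℕ) : (nawConst d + 1) ^ n ≤ (nawCount (d + 1) n : ℝ) := by
  rw [add_pow]
  calc ∑ m ∈ Finset.range (n + 1), nawConst d ^ m * 1 ^ (n - m) * (n.choose m : ℝ)
      ≤ ∑ m ∈ Finset.range (n + 1), (nawCount d m : ℝ) * 1 * (n.choose m : ℝ) := by
        refine Finset.sum_le_sum fun m _ => ?_
        rw [one_pow]
        gcongr
        exact pow_nawConst_le_nawCount m
    _ = ((∑ m ∈ Finset.range (n + 1), n.choose m * nawCount d m : ℕ) : ℝ) := by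
        push_cast
        exact Finset.sum_congr rfl fun m _ => by ring
    _ ≤ nawCount (d + 1) n := by exact_mod_cast sum_choose_mul_nawCount_le' n

/-- **`μ_NAW(ℤ^d) + 1 ≤ μ_NAW(ℤ^{d+1})`** (`d ≥ 1`): the unit gap of the neighbour-avoiding connective constant under an added dimension
(`μ_NAW` is the infimum `inf_n N_n^{1/n}`, so no limit is needed; lane numerics: `4.046 + 1 ≤ 5.99`, `5.99 + 1 ≤ 7.97`). [folklore] -/
theorem nawConst_add_one_le (d : ℕ) [NeZero d] : nawConst d + 1 ≤ nawConst (d + 1) := by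
  refine le_ciInf fun n => ?_
  have hlow := add_one_pow_le_nawCount_succ (d := d) (n + 1)
  have hpos : (0 : ℝ) < (n : ℝ) + 1 := by positivity
  have hd : (0 : ℝ) ≤ nawConst d + 1 := by
    have := (nawConst_pos (d := d)).le; positivity
  calc nawConst d + 1 = ((nawConst d + 1) ^ (n + 1)) ^ (1 / ((n : ℝ) + 1)) := by
        rw [← Real.rpow_natCast, ← Real.rpow_mul hd, Nat.cast_succ, mul_one_div_cancel hpos.ne', Real.rpow_one]
    _ ≤ (nawCount (d + 1) (n + 1) : ℝ) ^ (1 / ((n : ℝ) + 1)) := Real.rpow_le_rpow (pow_nonneg hd _) hlow (by positivity)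

/-- **`μ_NAW(ℤ^d) < μ_NAW(ℤ^{d+1})`** (`d ≥ 1`). [folklore] -/
theorem nawConst_lt_succ (d : ℕ) [NeZero d] : nawConst d < nawConst (d + 1) :=
  lt_of_lt_of_le (lt_add_one _) (nawConst_add_one_le d)

/-- `μ_NAW(ℤ^d) + j ≤ μ_NAW(ℤ^{d+j})` (`d ≥ 1`). [folklore] -/
theorem nawConst_add_nat_le (d : ℕ) [NeZero d] : ∀ j : ℕ, nawConst d + j ≤ nawConst (d + j)
  | 0 => by simp
  | j + 1 => by
    haveI : NeZero (d + j) := ⟨by have := NeZero.ne d; omega⟩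
    calc nawConst d + ((j + 1 : ℕ) : ℝ) = (nawConst d + j) + 1 := by push_cast; ring
      _ ≤ nawConst (d + j) + 1 := by gcongr; exact nawConst_add_nat_le d j
      _ ≤ nawConst (d + j + 1) := nawConst_add_one_le (d + j)

/-- **The site endpoints `1/μ_NAW(ℤ^d)` are strictly decreasing in `d`** (`d ≥ 1`): `1/μ_NAW(ℤ^{d+1}) < 1/μ_NAW(ℤ^d)`. [folklore] -/
theorem inv_nawConst_succ_lt (d : ℕ) [NeZero d] : (nawConst (d + 1))⁻¹ < (nawConst d)⁻¹ :=
  (inv_lt_inv₀ (nawConst_pos (d := d + 1)) (nawConst_pos (d := d))).2 (nawConst_lt_succ d)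

end Summit.CriticalPhenomena.PercolationContinuityZ3.Theorems.Pcint.NawTail

end
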